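import Summits.CriticalPhenomena.CardyFormulaZ2.Theorems.CardyMagicRigidityMarkovCascadeDefs
import Literature.Probability.Percolation.CLE6FiniteTraces
import Literature.Probability.Percolation.SiteNestingWeightBound
import Mathlib.Combinatorics.Pigeonhole
import HarnessLib

/-!
# The number of macroscopic interface loops of site-`𝕋` in a ball is tight

Crux `Summit.CriticalPhenomena.CardyFormulaZ2.Theses.CardyMagicRigidity.NestingRigidity`
(stmt-CriticalPhenomena-4835), line `markov-cascade-one-generation`, registered helper stub
`tight_encard_bigLoops_siteLoopConfig` (finite-depth tightness input of the Markov cascade on `𝕋`;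
vocabulary `Theorems/CardyMagicRigidityMarkovCascadeDefs.lean`: `PT = triSitePercolation half`).

**Statement.** For every `R`, `η > 0`, `ε > 0` there is `N` such that for all small `δ > 0`, with
`P_{1/2}`-probability at least `1 - ε` at most `N` loops of the typed full-plane loop configuration
`siteLoopConfig δ ω` (`FullPlaneCNL.lean`) of trace-diameter `≥ η` have their trace inside `B(0, R)`.

**Proof** (Camia–Newman, Comm. Math. Phys. 268 (2006), Thm 2 (ii), through Aizenman–Burchard 1999,
App. A, as already assembled in the tree for the closed-b.c. collections in `CLE6FiniteTraces.lean`).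
Cover `B̄(0, R)` by `m` balls `B(x, η/32)`.  If more than `N = m (2j + 1)` big loops lie in `B(0, R)`,
pick `N + 1` of them; they are the unbased loops of interface loops `γ_i` of `ω`
(`IsSiteInterfaceLoop ω γ_i`) with PAIRWISE DISTINCT traces (two interface loops of one configuration
whose traces meet share a face, `exists_mem_support_of_mem_polyPiece`, hence define the same unbased
loop after rebasing, `IsSiteInterfaceLoop.exists_rebase` + `eq_of_base_eq`), each of diameter `> η/2`
and meeting one of the covering balls; by pigeonhole `2j + 2` of them meet one ball `B(x, η/32)`, so
`ω` has `j` disjoint open arms across `A(x; η/32 + 9δ, η/8 - 9δ)`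
(`mem_disjointOccurrencePow_of_distinct_loops`, `CLE6FiniteTraces.lean`, over the several-loops
Aizenman–Burchard lemma `mem_disjointOccurrencePow_of_loops` of `LoopCrossingArms.lean`), an event of
probability `≤ 3^{-α j}` (`real_disjointOccurrencePow_triArm_le`: BK and the RSW annulus bound).  Summing
over the `m` centres and choosing `j` with `m 3^{-α j} ≤ ε` gives the claim for `0 < δ ≤ η/32000`.
No measurability is needed (monotonicity and finite subadditivity of the outer measure).
-/

noncomputable section

open MeasureTheory Set Filter
open scoped Topology BigOperators ENNReal Real

namespace Summit.CriticalPhenomena.CardyFormulaZ2.Cruxes.NestingRigidity.MarkovCascadeOneGeneration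

open Literature.Probability.RandomPlanarGeometry Literature.Probability.Percolation
  Literature.Probability.LatticeModels
open Summit.CriticalPhenomena.CardyFormulaZ2.Theses.CardyMagicRigidity

/-! ### Loops of `siteLoopConfig` as interface polygons -/

/-- Every loop of `siteLoopConfig δ ω` (either type) is the unbased loop of an interface loop of `ω`
drawn at mesh `δ`. -/
theorem exists_walk_of_mem_loops_siteLoopConfig {δ : ℝ} {ω : SiteConfig (Site 2)} {u : UnbasedLoop ℂ}
    (hu : u ∈ (siteLoopConfig δ ω).loops) :
    ∃ (F : HexVertex) (γ : hexGraph.Walk F F), IsSiteInterfaceLoop ω γ ∧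
      UnbasedLoop.mk (BasedLoop.mk (siteLoopCurve δ γ) (isLoop_siteLoopCurve δ γ)) = u := by
  rcases hu with ⟨v, γ, hγ, -, rfl⟩ | ⟨v, γ, hγ, -, rfl⟩ <;> exact ⟨v, γ, hγ, rfl⟩

/-- The trace of the unbased loop of an interface loop drawn at mesh `δ` is the lattice trace
`polyTrace δ γ` of its polygon. -/
theorem range_mk_siteLoopCurve_eq_polyTrace {δ : ℝ} {ω : SiteConfig (Site 2)} {F : HexVertex}
    {γ : hexGraph.Walk F F} (hγ : IsSiteInterfaceLoop ω γ) :
    (UnbasedLoop.mk (BasedLoop.mk (siteLoopCurve δ γ) (isLoop_siteLoopCurve δ γ))).range =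
      polyTrace δ γ := by
  rw [range_mk_siteLoopCurve]
  exact range_toCurve_eq_polyTrace (by have := hγ.three_le_length; omega)

/-- **Distinct loops of one configuration have distinct traces.** If two interface loops of `ω`
drawn at mesh `δ ≠ 0` define different unbased loops, their polygon traces differ: were the traces
equal, a point of the first trace would lie on dart pieces of both polygons, which then share a face
(`exists_mem_support_of_mem_polyPiece`); rebasing both loops at that face
(`IsSiteInterfaceLoop.exists_rebase`) gives two interface loops of `ω` based at one face, which
coincide (`IsSiteInterfaceLoop.eq_of_base_eq`), so the unbased loops coincide. -/
theorem polyTrace_ne_of_unbasedLoop_ne {ω : SiteConfig (Site 2)} {δ : ℝ} (hδ : δ ≠ 0)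
    {F F' : HexVertex} {γ : hexGraph.Walk F F} {γ' : hexGraph.Walk F' F'}
    (hγ : IsSiteInterfaceLoop ω γ) (hγ' : IsSiteInterfaceLoop ω γ')
    (hne : UnbasedLoop.mk (BasedLoop.mk (siteLoopCurve δ γ) (isLoop_siteLoopCurve δ γ)) ≠
      UnbasedLoop.mk (BasedLoop.mk (siteLoopCurve δ γ') (isLoop_siteLoopCurve δ γ'))) :
    polyTrace δ γ ≠ polyTrace δ γ' := by
  intro heq
  have hlen : 0 < γ.length := by have := hγ.three_le_length; omega
  have hz : polyPt δ γ 0 ∈ polyTrace δ γ := polyPiece_subset_polyTrace hlen (left_mem_segment _ _ _)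
  have hz' : polyPt δ γ 0 ∈ polyTrace δ γ' := heq ▸ hz
  obtain ⟨i, hi, hzi⟩ := mem_polyTrace_iff.1 hz
  obtain ⟨j, hj, hzj⟩ := mem_polyTrace_iff.1 hz'
  obtain ⟨u, hu, hu'⟩ := exists_mem_support_of_mem_polyPiece hδ hi hj hzi hzj
  obtain ⟨w, hw, hwu⟩ := hγ.exists_rebase hu δ
  obtain ⟨w', hw', hwu'⟩ := hγ'.exists_rebase hu' δ
  have hww' : w = w' := hw.eq_of_base_eq hw'
  subst hww'
  exact hne (hwu.symm.trans hwu')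

/-! ### Too many big loops force many disjoint open arms near a covering centre -/

/-- **The lattice event behind "too many macroscopic loops".** Let the balls `B(x, η/32)`, `x ∈ Xs`,
cover `B̄(0, R)`, and let `0 < δ ≤ 3 (η/2) / 640`.  If more than `#Xs · (2j + 1)` loops of
`siteLoopConfig δ ω` with trace inside `B(0, R)` have diameter `≥ η`, then for some centre `x ∈ Xs`
the configuration `ω` has `j` disjoint confined open arms across `A(x; η/32 + 9δ, η/8 - 9δ)`:
choose `#Xs (2j + 1) + 1` such loops, represent them by interface loops of `ω` (pairwise distinct
traces, `polyTrace_ne_of_unbasedLoop_ne`), send each to a covering ball its trace meets, extract by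
pigeonhole `2j + 2` of them at one centre and apply `mem_disjointOccurrencePow_of_distinct_loops`
(diameter `> η/2`). -/
theorem exists_mem_disjointOccurrencePow_of_lt_encard {R η δ : ℝ} (hη : 0 < η) (hδ : 0 < δ)
    (hδη : δ ≤ 3 * (η / 2) / 640) {Xs : Finset ℂ}
    (hcover : Metric.closedBall (0 : ℂ) R ⊆ ⋃ x ∈ Xs, Metric.ball x (η / 2 / 16)) {j : ℕ}
    {ω : SiteConfig (Site 2)}
    (hω : ((Xs.card * (2 * j + 1) : ℕ) : ℕ∞) < {u ∈ (siteLoopConfig δ ω).loops |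
      u.range ⊆ Metric.ball (0 : ℂ) R ∧ η ≤ Metric.diam u.range}.encard) :
    ∃ x ∈ Xs, ω ∈ disjointOccurrencePow (triArm δ x (η / 2 / 16 + 9 * δ) (η / 2 / 4 - 9 * δ)) j := by
  classical
  -- `#Xs (2j + 1) + 1` distinct big loops
  obtain ⟨t, htS, htcard⟩ := Set.exists_subset_encard_eq
    (show ((Xs.card * (2 * j + 1) + 1 : ℕ) : ℕ∞) ≤ {u ∈ (siteLoopConfig δ ω).loops |
      u.range ⊆ Metric.ball (0 : ℂ) R ∧ η ≤ Metric.diam u.range}.encard by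
      push_cast
      exact Order.add_one_le_of_lt hω)
  have htfin : t.Finite := Set.finite_of_encard_eq_coe htcard
  have hcardT : htfin.toFinset.card = Xs.card * (2 * j + 1) + 1 := by
    have h := htfin.encard_eq_coe_toFinset_card
    rw [htcard] at h
    exact_mod_cast h.symm
  set e := (htfin.toFinset.equivFinOfCardEq hcardT).symm with he
  set u : Fin (Xs.card * (2 * j + 1) + 1) → UnbasedLoop ℂ := fun i ↦ (e i : UnbasedLoop ℂ) with hudef
  have huS : ∀ i, u i ∈ {u ∈ (siteLoopConfig δ ω).loops |
      u.range ⊆ Metric.ball (0 : ℂ) R ∧ η ≤ Metric.diam u.range} :=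
    fun i ↦ htS (htfin.mem_toFinset.1 (e i).2)
  have huinj : Function.Injective u := fun i i' h ↦ e.injective (Subtype.ext h)
  -- interface loops representing them
  have hrep : ∀ i, ∃ (F : HexVertex) (γ : hexGraph.Walk F F), IsSiteInterfaceLoop ω γ ∧
      UnbasedLoop.mk (BasedLoop.mk (siteLoopCurve δ γ) (isLoop_siteLoopCurve δ γ)) = u i :=
    fun i ↦ exists_walk_of_mem_loops_siteLoopConfig (huS i).1
  choose F γ hγ hγu using hrep
  have hrange : ∀ i, (u i).range = polyTrace δ (γ i) := fun i ↦ by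
    rw [← hγu i]
    exact range_mk_siteLoopCurve_eq_polyTrace (hγ i)
  -- each trace meets a covering ball
  have hball : ∀ i, ∃ x ∈ Xs, ∃ z ∈ polyTrace δ (γ i), dist z x < η / 2 / 16 := by
    intro i
    have hlen : 0 < (γ i).length := by have := (hγ i).three_le_length; omega
    have hz : polyPt δ (γ i) 0 ∈ polyTrace δ (γ i) :=
      polyPiece_subset_polyTrace hlen (left_mem_segment _ _ _)
    have hzR : polyPt δ (γ i) 0 ∈ Metric.closedBall (0 : ℂ) R := by
      have h1 : polyPt δ (γ i) 0 ∈ (u i).range := by rw [hrange]; exact hz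
      exact Metric.ball_subset_closedBall ((huS i).2.1 h1)
    obtain ⟨x, hx, hzx⟩ := mem_iUnion₂.1 (hcover hzR)
    exact ⟨x, hx, _, hz, Metric.mem_ball.1 hzx⟩
  choose φ hφ hzφ using hball
  obtain ⟨x, hx, hcard⟩ := Finset.exists_lt_card_fiber_of_mul_lt_card_of_maps_to
    (t := Xs) (f := φ) (n := 2 * j + 1) (fun i _ ↦ hφ i)
    (by rw [Finset.card_univ, Fintype.card_fin]; exact lt_add_one _)
  -- `2j + 2` loops in the fibre of `x`
  set S₁ := Finset.univ.filter fun i : Fin (Xs.card * (2 * j + 1) + 1) ↦ φ i = x with hS₁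
  obtain ⟨S', hS'S, hS'card⟩ := Finset.exists_subset_card_eq (show 2 * j + 2 ≤ S₁.card by omega)
  set e' := (S'.equivFinOfCardEq hS'card).symm with he'
  have heS : ∀ l, φ (e' l) = x := fun l ↦ (Finset.mem_filter.1 (hS'S (e' l).2)).2
  refine ⟨x, hx, ?_⟩
  refine mem_disjointOccurrencePow_of_distinct_loops (x := x) (j := j) hδ (by positivity : (0 : ℝ) < η / 2)
    hδη (f := fun l ↦ F (e' l)) (w := fun l ↦ γ (e' l)) (fun l ↦ hγ (e' l)) (fun l l' hll' ↦ ?_)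
    (fun l ↦ ?_) (fun l ↦ ?_)
  · -- distinct loops have distinct traces
    refine polyTrace_ne_of_unbasedLoop_ne hδ.ne' (hγ _) (hγ _) ?_
    rw [hγu, hγu]
    intro h
    exact hll' (e'.injective (Subtype.ext (huinj h)))
  · -- diameter `> η / 2`
    have h := (huS (e' l)).2.2
    rw [hrange] at h
    change η / 2 < Metric.diam (polyTrace δ (γ (e' l)))
    linarith
  · -- the trace meets `B̄(x, η/32)`
    obtain ⟨z, hz, hzx⟩ := hzφ (e' l)
    exact ⟨z, hz, by rw [← heS l]; exact hzx.le⟩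

/-! ### The theorem -/

/-- **Tightness of the number of macroscopic interface loops of site-`𝕋` in a ball** (Camia–Newman
2006, Thm 2 (ii); Aizenman–Burchard 1999, App. A): for every `R`, `η > 0`, `ε > 0` there is `N` such
that for all small `δ > 0` the `P_{1/2}`-probability that more than `N` loops of `siteLoopConfig δ ω`
with trace in `B(0, R)` have diameter `≥ η` is at most `ε`.  Proof: `exists_mem_disjointOccurrencePow_of_lt_encard`
with a finite `η/32`-cover of `B̄(0, R)`, finite subadditivity, the BK/RSW bound
`real_disjointOccurrencePow_triArm_le` (`≤ 3^{-α j}` per centre for `0 < δ ≤ η/32000`) and a choice of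
`j` with `#Xs · 3^{-α j} ≤ ε`. -/
theorem tight_encard_bigLoops_siteLoopConfig : ∀ (R η ε : ℝ), 0 < η → 0 < ε → ∃ N : ℕ, ∀ᶠ δ in 𝓝[>] (0 : ℝ), PT {ω | (N : ℕ∞) < {u ∈ (siteLoopConfig δ ω).loops | u.range ⊆ Metric.ball (0 : ℂ) R ∧ η ≤ Metric.diam u.range}.encard} ≤ ENNReal.ofReal ε := by
  intro R η ε hη hε
  classical
  obtain ⟨α, hα, hb⟩ := tri_annulusCrossing_bound_holds
  -- cover the closed ball by finitely many balls of radius `η / 32`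
  obtain ⟨Xs₀, -, hXfin, hcover₀⟩ :=
    finite_cover_balls_of_compact (isCompact_closedBall (0 : ℂ) R) (show (0 : ℝ) < η / 2 / 16 by positivity)
  set Xs : Finset ℂ := hXfin.toFinset with hXs
  have hcover : Metric.closedBall (0 : ℂ) R ⊆ ⋃ x ∈ Xs, Metric.ball x (η / 2 / 16) := by
    intro z hz
    obtain ⟨x, hx, hzx⟩ := mem_iUnion₂.1 (hcover₀ hz)
    exact mem_iUnion₂.2 ⟨x, hXfin.mem_toFinset.2 hx, hzx⟩
  set θ : ℝ := (1 / 3 : ℝ) ^ α with hθ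
  have hθ0 : 0 ≤ θ := by positivity
  have hθ1 : θ < 1 := Real.rpow_lt_one (by norm_num) (by norm_num) hα
  -- the number of arms
  obtain ⟨j, hj⟩ : ∃ j : ℕ, (Xs.card : ℝ) * θ ^ j ≤ ε := by
    have ht : Tendsto (fun j : ℕ ↦ (Xs.card : ℝ) * θ ^ j) atTop (𝓝 ((Xs.card : ℝ) * 0)) :=
      (tendsto_pow_atTop_nhds_zero_of_lt_one hθ0 hθ1).const_mul _
    rw [mul_zero] at ht
    exact (ht.eventually (eventually_le_nhds hε)).exists
  refine ⟨Xs.card * (2 * j + 1), ?_⟩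
  filter_upwards [Ioc_mem_nhdsGT (show (0 : ℝ) < η / 2 / 16000 by positivity)] with δ hδ
  obtain ⟨hδ0, hδε⟩ := hδ
  have hsub : {ω : SiteConfig (Site 2) | ((Xs.card * (2 * j + 1) : ℕ) : ℕ∞) <
      {u ∈ (siteLoopConfig δ ω).loops | u.range ⊆ Metric.ball (0 : ℂ) R ∧ η ≤ Metric.diam u.range}.encard} ⊆
      ⋃ x ∈ Xs, disjointOccurrencePow (triArm δ x (η / 2 / 16 + 9 * δ) (η / 2 / 4 - 9 * δ)) j := by
    intro ω hω
    obtain ⟨x, hx, hωx⟩ := exists_mem_disjointOccurrencePow_of_lt_encard hη hδ0 (by linarith) hcover hω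
    exact mem_iUnion₂.2 ⟨x, hx, hωx⟩
  calc PT {ω : SiteConfig (Site 2) | ((Xs.card * (2 * j + 1) : ℕ) : ℕ∞) <
        {u ∈ (siteLoopConfig δ ω).loops | u.range ⊆ Metric.ball (0 : ℂ) R ∧ η ≤ Metric.diam u.range}.encard}
      ≤ PT (⋃ x ∈ Xs, disjointOccurrencePow (triArm δ x (η / 2 / 16 + 9 * δ) (η / 2 / 4 - 9 * δ)) j) :=
        measure_mono hsub
    _ = ENNReal.ofReal ((triSitePercolation half).real
          (⋃ x ∈ Xs, disjointOccurrencePow (triArm δ x (η / 2 / 16 + 9 * δ) (η / 2 / 4 - 9 * δ)) j)) :=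
        (ofReal_measureReal (measure_ne_top _ _)).symm
    _ ≤ ENNReal.ofReal (∑ x ∈ Xs, (triSitePercolation half).real
          (disjointOccurrencePow (triArm δ x (η / 2 / 16 + 9 * δ) (η / 2 / 4 - 9 * δ)) j)) :=
        ENNReal.ofReal_le_ofReal (measureReal_biUnion_finset_le _ _)
    _ ≤ ENNReal.ofReal (∑ _x ∈ Xs, θ ^ j) :=
        ENNReal.ofReal_le_ofReal (Finset.sum_le_sum fun x _ ↦
          real_disjointOccurrencePow_triArm_le hα hb hδ0 (by positivity : (0 : ℝ) < η / 2) hδε x j)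
    _ = ENNReal.ofReal (Xs.card * θ ^ j) := by rw [Finset.sum_const, nsmul_eq_mul]
    _ ≤ ENNReal.ofReal ε := ENNReal.ofReal_le_ofReal hj

end Summit.CriticalPhenomena.CardyFormulaZ2.Cruxes.NestingRigidity.MarkovCascadeOneGeneration

end
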